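import Summits.CriticalPhenomena.Ising3DConformalLimit.Theses.PerfectScreening
import Summits.CriticalPhenomena.Ising3DConformalLimit.Theses.EnergyNotSigmaSquared
import Summits.CriticalPhenomena.Ising3DConformalLimit.Theses.HyperoctahedralRP
import Summits.CriticalPhenomena.Ising3DConformalLimit.Theorems.EnergyNotSigmaSquaredMoebiusLimitExistsOrbitLiouvilleDictionary
import Summits.CriticalPhenomena.Ising3DConformalLimit.Theorems.EnergyNotSigmaSquaredMoebiusLimitExistsOrbitLiouvillePeriodicLiouville
import Summits.CriticalPhenomena.Ising3DConformalLimit.Theorems.EnergyNotSigmaSquaredMoebiusLimitExistsOrbitLiouvilleOrbitConst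
import Summits.CriticalPhenomena.Ising3DConformalLimit.Theorems.EnergyNotSigmaSquaredMoebiusLimitExistsOrbitLiouvilleInversionOfOrbitGood
import Summits.CriticalPhenomena.Ising3DConformalLimit.Theorems.MoebiusLimitExists.Negative.MeshContinuity
import Summits.CriticalPhenomena.Ising3DConformalLimit.Theorems.MoebiusLimitExists.Negative.FreeReflections
import Summits.CriticalPhenomena.Ising3DConformalLimit.Theorems.PrecisionLaplacianMoebiusLimitOfTwoPointLawInversionBegetsRotations
import HarnessLib

/-!
# Line `Sketch` (§1 complex-circle-rotation-liouville) for crux `MoebiusLimitExists` — the reduction, sorry-free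

Crux stmt-CriticalPhenomena-1344 (`Theses.PerfectScreening.MoebiusLimitExists` = `Theses.EnergyNotSigmaSquared.MoebiusLimit`,
one term). This file lands the COMPOSITION of the line as tree theorems, with the line's single open stub S4
(`stub_orbitEntire_of_limit`: ORBIT-ENTIRE for every normalised 1981-type limit) kept as an explicit hypothesis:

* `isInversionCovariant_of_orbitEntire'` — ORBIT-ENTIRE ⇒ inversion covariance for a normalised, continuous,
  `R₃`-symmetric family (the card's `InversionOfEntireOrbits`): composition of the landed stubs S1
  `stub_periodicTemperedLiouville` (p128155), S2 `stub_flowAlgebra` (p128058), S3a `stub_orbitConst` (p128039),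
  S3b `stub_inversion_of_orbitGood` (p128083).
* `flip_invariant_of_limit'` — `R₃` is a free symmetry of every limit (`limit_signFlip`).
* `MoebiusLimitExists_of_orbitEntire` — item 1981 (`ExistsScaleCovariantLimit`) ∧ S4 ⇒ crux (mesh continuity,
  the free flip, the reduction, rotations from inversion + translations `stub_inversionBegetsRotations`).
* `MoebiusLimitExists_iff_orbitEntire` — **crux ⟺ 1981 ∧ S4** (converse from the dictionary file:
  `existsScaleCovariantLimit_of_MoebiusLimitExists`, `stub_orbitEntire_of_crux`), the kernel-checked SIZE of
  the line's residual: given existence (1981), Möbius covariance of the 3D Ising scaling limit IS the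
  statement that the weighted orbit functions of the limit along the elliptic flow about the unit circle are
  restrictions of `2π`-periodic tempered entire functions of the angle — a domain-of-holomorphy statement
  for one function of one complex variable per configuration; and `S4 ⟺ 1980 ∧ 1982` given 1981
  (`orbitEntireForLimits_iff_items`).

References: Di Francesco–Mathieu–Sénéchal 1997 §4.3.1; Duminil-Copin ICM 2022 §8.1, §8.4 (the conjecture).
-/

noncomputable section

open Set Function Filter EuclideanGeometry
open scoped Topology
open Literature.Probability.LatticeModels

namespace Summit.CriticalPhenomena.Ising3DConformalLimit.MoebiusLimitExistsOrbitLiouville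

/-- `R₃` is the signed coordinate map with signs `(1, 1, −1)`. [folklore] -/
theorem flipThree_apply_signs' (p : EuclideanSpace ℝ (Fin 3)) (j : Fin 3) :
    flipThree p j = (((fun k : Fin 3 => if k = 2 then (-1 : ℤˣ) else 1) j : ℤ) : ℝ) * p j := by
  rw [flipThree_apply]
  by_cases h : j = 2
  · subst h; simp
  · simp [h]

/-- **`R₃` is a free symmetry of every pointwise limit of the critical correlators** on `NonCoincident`
(tree: `MoebiusLimitExistsNegative.limit_signFlip`). [cite: FriedliVelenik2017, Exercise 3.14, p. 115] -/
theorem flip_invariant_of_limit' {ρ : ℝ → ℝ} {S : CorrFamily 3}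
    (hlim : HasPointwiseScalingLimit (criticalCorr 3) ρ S) :
    ∀ n (x : Fin n → EuclideanSpace ℝ (Fin 3)), x ∈ NonCoincident 3 n →
      S n (fun i => flipThree (x i)) = S n x :=
  fun _ _ hx => MoebiusLimitExistsNegative.limit_signFlip hlim (fun k : Fin 3 => if k = 2 then (-1 : ℤˣ) else 1)
    flipThree flipThree_apply_signs' hx

/-- **ORBIT-ENTIRE ⇒ INVERSION COVARIANCE** for a normalised, continuous, `R₃`-symmetric family (the
card's `InversionOfEntireOrbits`): composition of the landed stubs S1, S2, S3a, S3b. [folklore] -/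
theorem isInversionCovariant_of_orbitEntire' (Δ : ℝ) (S : CorrFamily 3)
    (hnorm : ∀ n z, z ∉ NonCoincident 3 n → S n z = 0)
    (hcont : ∀ n, ContinuousOn (S n) (NonCoincident 3 n))
    (hflip : ∀ n (x : Fin n → EuclideanSpace ℝ (Fin 3)), x ∈ NonCoincident 3 n →
      S n (fun i => flipThree (x i)) = S n x)
    (hOE : OrbitEntire Δ S) : IsInversionCovariant Δ S :=
  stub_inversion_of_orbitGood Δ S hnorm hcont hflip fun n x hx =>
    stub_orbitConst stub_periodicTemperedLiouville stub_flowAlgebra Δ S n x hx (hOE n x hx)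

/-- **1981 ∧ S4 ⇒ crux**: the line's composition with its single open stub S4 as a hypothesis (second
argument, VERBATIM the registered signature of `stub_orbitEntire_of_limit`). [folklore] -/
theorem MoebiusLimitExists_of_orbitEntire
    (hE : Theses.HyperoctahedralRP.ExistsScaleCovariantLimit)
    (hOE : ∀ (ρ : ℝ → ℝ) (Δ : ℝ) (S : CorrFamily 3), (∀ δ ∈ Set.Ioc (0:ℝ) 1, 0 < ρ δ) → 0 < Δ →
      HasPointwiseScalingLimit (criticalCorr 3) ρ S →
      (∀ n z, z ∉ NonCoincident 3 n → S n z = 0) → IsNondegenerateTwoPoint S →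
      IsTranslationInvariant S → IsScaleCovariant Δ S → OrbitEntire Δ S) :
    Theses.PerfectScreening.MoebiusLimitExists := by
  obtain ⟨ρ, Δ, S, hρ, hΔ, hlim, hnorm, hnd, htr, hsc⟩ := hE
  have hcont : ∀ n, ContinuousOn (S n) (NonCoincident 3 n) := fun n =>
    LimitMeshContinuity.continuousOn_limit_of_translationInvariant hlim htr n
  have hinv : IsInversionCovariant Δ S :=
    isInversionCovariant_of_orbitEntire' Δ S hnorm hcont (flip_invariant_of_limit' hlim)
      (hOE ρ Δ S hρ hΔ hlim hnorm hnd htr hsc)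
  have hrot : IsRotationInvariant S :=
    PrecisionLaplacianMoebiusLimitOfTwoPointLaw.stub_inversionBegetsRotations Δ S htr hinv
  exact ⟨ρ, Δ, S, hρ, hΔ, hlim, hnd, ⟨htr, hrot⟩, hsc, hinv⟩

/-- **crux ⟺ 1981 ∧ S4** — the kernel-checked size of the line's residual: given existence (item
stmt-1981), Möbius covariance of the 3D Ising scaling limit is EXACTLY orbit-entirety of the limit's
weighted orbit functions along the elliptic flow about the unit circle.
[cite: DuminilCopinICM2022, §8.1 p. 25 and §8.4 p. 29] -/
theorem MoebiusLimitExists_iff_orbitEntire :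
    Theses.PerfectScreening.MoebiusLimitExists ↔
      Theses.HyperoctahedralRP.ExistsScaleCovariantLimit ∧
      (∀ (ρ : ℝ → ℝ) (Δ : ℝ) (S : CorrFamily 3), (∀ δ ∈ Set.Ioc (0:ℝ) 1, 0 < ρ δ) → 0 < Δ →
        HasPointwiseScalingLimit (criticalCorr 3) ρ S →
        (∀ n z, z ∉ NonCoincident 3 n → S n z = 0) → IsNondegenerateTwoPoint S →
        IsTranslationInvariant S → IsScaleCovariant Δ S → OrbitEntire Δ S) :=
  ⟨fun h => ⟨MoebiusLimitExistsOnlyInteraction.existsScaleCovariantLimit_of_MoebiusLimitExists h,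
    stub_orbitEntire_of_crux h⟩, fun h => MoebiusLimitExists_of_orbitEntire h.1 h.2⟩

/-- **Given 1981, S4 ⟺ items 1980 ∧ 1982**: the bet of the line is the covariance half of the conjecture
(`stub_orbitEntire_of_items`; `MoebiusLimitExists_iff_hrp`, p114842). [cite: DuminilCopinICM2022, §8.4 p. 29] -/
theorem orbitEntireForLimits_iff_items (hE : Theses.HyperoctahedralRP.ExistsScaleCovariantLimit) :
    (∀ (ρ : ℝ → ℝ) (Δ : ℝ) (S : CorrFamily 3), (∀ δ ∈ Set.Ioc (0:ℝ) 1, 0 < ρ δ) → 0 < Δ →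
        HasPointwiseScalingLimit (criticalCorr 3) ρ S →
        (∀ n z, z ∉ NonCoincident 3 n → S n z = 0) → IsNondegenerateTwoPoint S →
        IsTranslationInvariant S → IsScaleCovariant Δ S → OrbitEntire Δ S) ↔
      Theses.HyperoctahedralRP.LimitRotationInvariant ∧ Theses.HyperoctahedralRP.InversionUpgradeNormalised := by
  constructor
  · intro hOE
    have h := MoebiusLimitExists_of_orbitEntire hE hOE
    exact ⟨MoebiusLimitExistsOnlyInteraction.limitRotationInvariant_of_MoebiusLimitExists h,
      MoebiusLimitExistsOnlyInteraction.inversionUpgradeNormalised_of_MoebiusLimitExists h⟩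
  · exact fun h => stub_orbitEntire_of_items h.1 h.2

/-- The reduction under the primary route's spelling of the crux (`Theses.EnergyNotSigmaSquared.MoebiusLimit`;
one term). [folklore] -/
theorem MoebiusLimit_iff_orbitEntire :
    Theses.EnergyNotSigmaSquared.MoebiusLimit ↔
      Theses.HyperoctahedralRP.ExistsScaleCovariantLimit ∧
      (∀ (ρ : ℝ → ℝ) (Δ : ℝ) (S : CorrFamily 3), (∀ δ ∈ Set.Ioc (0:ℝ) 1, 0 < ρ δ) → 0 < Δ →
        HasPointwiseScalingLimit (criticalCorr 3) ρ S →
        (∀ n z, z ∉ NonCoincident 3 n → S n z = 0) → IsNondegenerateTwoPoint S →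
        IsTranslationInvariant S → IsScaleCovariant Δ S → OrbitEntire Δ S) :=
  MoebiusLimitExists_iff_orbitEntire

end Summit.CriticalPhenomena.Ising3DConformalLimit.MoebiusLimitExistsOrbitLiouville

end
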